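import Literature.Analysis.FluidPDE.AxisymmetricVorticityTransport
import Literature.Analysis.FunctionSpaces.LittlewoodPaleyKernel
import Literature.Analysis.FunctionSpaces.TorusDirichletKernelProofs
import Mathlib.Analysis.SpecialFunctions.Integrals.Basic
import Mathlib.MeasureTheory.Integral.IntervalIntegral.Periodic
import HarnessLib

/-!
# Palasek 2021, Prop 1 (axisymmetric Bernstein inequality): the case `p = ∞`, `q = 3` for blocks

Analysis/FluidPDE proof file (theorems only, no definitions, no named facts), a step of the inline
programme for `Literature.Analysis.FluidPDE.palasek2021_axisym_quantitative_ess` (S. Palasek,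
arXiv:2101.08586 = Arch. Ration. Mech. Anal. 242 (2021), Thm 1 in the case `q = 3`, `u`
axisymmetric).

Palasek, Prop 1 (weighted Bernstein inequality), axisymmetric case: for a Fourier multiplier `T_m`
with symbol supported in `B(0, N)`, `1 ≤ q ≤ p ≤ ∞`, and `|u|` axisymmetric,
`‖r^α T_m u‖_{L^p} ≲ M N^{3/q − 3/p + β − α} ‖r^β u‖_{L^q}` provided `α ≤ β + 1/q − 1/p` (and the
side conditions); `r` the distance to the axis. The proof of the main estimate Prop 11 uses the
instance `p = ∞`, `β = 0`, `α = 1 − θ_q = 1 − 2/q` (p. 45: "`A₁⁻¹N₀ ≤ |P_{N₀}u(t₀,x₀)| ≤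
r(x₀)^{−1+θ_q}‖r^{1−θ_q}P_{N₀}u(t₀)‖_{L^∞} ≲ r(x₀)^{−1+θ_q}N₀^{θ_q}A` and therefore
`|x₀| ≲ A₁^{O(1)}N₀⁻¹`"), which at `q = 3` reads

  `r(x)^{1/3} |Δ̇_j u(x)| ≲ 2^{2j/3} ‖u‖_{L³}`   for `|u|` axisymmetric.

This file proves exactly this instance for the tree's Littlewood–Paley blocks `Δ̇_j = blockFn j`
(`Literature.Analysis.FunctionSpaces.blockFn`, convolution with the real Schwartz kernel
`K_j = 2^{3j}K₀(2^j·)`), by a **shorter road than the printed dyadic-shell/pigeonhole argument**,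
available because `|u|` is exactly (not only comparably) axisymmetric: since Lebesgue measure and
`|u|` are invariant under the rotations `R_θ` about the axis,
`∫ |K_j(x − y)| |u(y)| dy = ∫ K̄_j(x, y) |u(y)| dy` with the angular average
`K̄_j(x,y) = (2π)⁻¹∫₀^{2π} |K_j(x − R_θ y)| dθ`; the Schwartz decay `|K₀(z)| ≲ (1 + |z|)⁻⁴` and the
elementary bound `(2π)⁻¹∫₀^{2π} (1 + |x − R_θy|)⁻⁴ dθ ≲ (1 + r(x))⁻¹` (the circle `{R_θy}` meets the
unit ball about `x` in an arc of angle `≲ (r(x)r(y))^{-1/2}`) give `sup_y K̄_j(x,y) ≲ 2^{3j}(1 + 2^j r(x))⁻¹`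
while `∫ K̄_j(x,y) dy = ‖K_j‖_{L¹} = ‖K₀‖_{L¹}`, whence `‖K̄_j(x,·)‖_{L^{3/2}} ≲ 2^j(1 + 2^jr(x))^{-1/3}`
and Hölder concludes.

Main statements:

* `exists_angle_horizontal_inner` — `x₀(R_θy)₀ + x₁(R_θy)₁ = r(x)r(y)cos(θ − θ₀)`;
* `norm_sub_rotZ_sq_ge` — `|x − R_θy|² ≥ r(x)² + r(y)² − 2r(x)r(y)cos(θ − θ₀)`;
* `integral_angular_japanese_le` — `∫₀^{2π} (1 + |x − R_θy|)⁻⁴ dθ ≤ 8π/(1 + r(x))`;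
* `exists_blockKernel_zero_le` — `|K₀(z)| ≤ C_K(1 + |z|)⁻⁴` (Schwartz decay), and the dyadic
  scaling `|K_j(z)| ≤ C_K 2^{3j}(1 + 2^j|z|)⁻⁴`;
* `axisym_blockFn_weighted_bound` — **the instance of Prop 1**: there is an absolute `C` with
  `r(x)^{1/3} ‖Δ̇_j u(x)‖ ≤ C 2^{2j/3} ‖u‖_{L³}` for every field `u ∈ L³(ℝ³; E')` whose pointwise
  norm is axisymmetric and every `x`, `j`.

## References

* S. Palasek, arXiv:2101.08586 (ARMA 242, 2021), Prop 1 (§2.2) and its use in the proof of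
  Prop 11 (§5). [Palasek2021]
* H. Bahouri, J.-Y. Chemin, R. Danchin, *Fourier Analysis and Nonlinear PDE*, Springer 2011,
  Lemma 2.1 (Bernstein; the kernels `2^{jd}h(2^j·)`). [BCD]
-/

noncomputable section

open MeasureTheory Set Function Filter Topology Metric Real
open Literature.Analysis.FunctionSpaces
open scoped ENNReal NNReal RealInnerProductSpace

namespace Literature.Analysis.FluidPDE

namespace PalasekBernstein

local notation "ℝ³" => EuclideanSpace ℝ (Fin 3)

/-! ### Horizontal geometry of the rotations about the axis -/

/-- The orbit map `θ ↦ R_θ x` is continuous (cf. `continuous_rotZ_angle`,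
`AxisymmetricSingularSetOnAxis.lean`; re-proved to keep the imports light). [folklore] -/
private theorem continuous_rotZ_angle' (x : ℝ³) : Continuous fun θ : ℝ => rotZ θ x := by
  unfold rotZ
  refine (PiLp.continuous_toLp 2 _).comp ?_
  refine continuous_pi fun i => ?_
  have hc : Continuous fun θ : ℝ => Real.cos θ := Real.continuous_cos
  have hs : Continuous fun θ : ℝ => Real.sin θ := Real.continuous_sin
  fin_cases i
  · exact ((hc.mul (continuous_const (y := x 0))).sub
      (hs.mul (continuous_const (y := x 1)))).congr fun θ => by simp
  · exact ((hs.mul (continuous_const (y := x 0))).add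
      (hc.mul (continuous_const (y := x 1)))).congr fun θ => by simp
  · exact (continuous_const (y := x 2)).congr fun θ => by simp

/-- `(θ, x) ↦ R_θ x` is jointly continuous (cf. `continuous_rotZ_prod`,
`SereginZajaczkowski2007SwirlRotation.lean`; re-proved to keep the imports light). [folklore] -/
private theorem continuous_rotZ_prod' : Continuous fun p : ℝ × ℝ³ => rotZ p.1 p.2 := by
  unfold rotZ
  refine (PiLp.continuous_toLp 2 _).comp ?_
  refine continuous_pi fun i => ?_
  have h0 : Continuous fun p : ℝ × ℝ³ => p.2 0 := (PiLp.continuous_apply 2 _ 0).comp continuous_snd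
  have h1 : Continuous fun p : ℝ × ℝ³ => p.2 1 := (PiLp.continuous_apply 2 _ 1).comp continuous_snd
  have h2 : Continuous fun p : ℝ × ℝ³ => p.2 2 := (PiLp.continuous_apply 2 _ 2).comp continuous_snd
  have hc : Continuous fun p : ℝ × ℝ³ => Real.cos p.1 := Real.continuous_cos.comp continuous_fst
  have hs : Continuous fun p : ℝ × ℝ³ => Real.sin p.1 := Real.continuous_sin.comp continuous_fst
  fin_cases i
  · exact ((hc.mul h0).sub (hs.mul h1)).congr fun p => by simp
  · exact ((hs.mul h0).add (hc.mul h1)).congr fun p => by simp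
  · exact h2.congr fun p => by simp

/-- The horizontal inner product `x₀(R_θy)₀ + x₁(R_θy)₁` is `P cos θ + Q sin θ` with
`P = x₀y₀ + x₁y₁`, `Q = x₁y₀ − x₀y₁`, `P² + Q² = r(x)²r(y)²`. [folklore] -/
theorem horizontal_inner_rotZ (θ : ℝ) (x y : ℝ³) :
    x 0 * rotZ θ y 0 + x 1 * rotZ θ y 1 =
      (x 0 * y 0 + x 1 * y 1) * Real.cos θ + (x 1 * y 0 - x 0 * y 1) * Real.sin θ := by
  simp only [rotZ_apply_zero, rotZ_apply_one]
  ring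

/-- **The phase of the horizontal inner product.** For `x, y ∈ ℝ³` there is an angle `θ₀` with
`x₀(R_θy)₀ + x₁(R_θy)₁ = r(x) r(y) cos(θ − θ₀)` for all `θ`. [folklore] -/
theorem exists_angle_horizontal_inner (x y : ℝ³) :
    ∃ θ₀ : ℝ, ∀ θ : ℝ, x 0 * rotZ θ y 0 + x 1 * rotZ θ y 1 = cylRadius x * cylRadius y * Real.cos (θ - θ₀) := by
  set P : ℝ := x 0 * y 0 + x 1 * y 1 with hP
  set Q : ℝ := x 1 * y 0 - x 0 * y 1 with hQ
  have hPQ : P ^ 2 + Q ^ 2 = (cylRadius x * cylRadius y) ^ 2 := by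
    rw [mul_pow, cylRadius_sq, cylRadius_sq, hP, hQ]
    ring
  set M : ℝ := cylRadius x * cylRadius y with hM
  have hM0 : 0 ≤ M := mul_nonneg (cylRadius_nonneg _) (cylRadius_nonneg _)
  by_cases hM00 : M = 0
  · -- degenerate: `P = Q = 0`
    have hP0 : P = 0 := by nlinarith [sq_nonneg P, sq_nonneg Q]
    have hQ0 : Q = 0 := by nlinarith [sq_nonneg P, sq_nonneg Q]
    refine ⟨0, fun θ => ?_⟩
    rw [horizontal_inner_rotZ, ← hP, ← hQ, hP0, hQ0, hM00]
    ring
  · have hMpos : 0 < M := lt_of_le_of_ne hM0 (Ne.symm hM00)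
    -- the unit vector `(P, Q)/M` as a complex number
    set w : ℂ := ⟨P / M, Q / M⟩ with hw
    have hwabs : ‖w‖ = 1 := by
      rw [Complex.norm_eq_sqrt_sq_add_sq]
      simp only [hw]
      rw [div_pow, div_pow, ← add_div, hPQ, div_self (pow_ne_zero 2 hM00), Real.sqrt_one]
    have hw0 : w ≠ 0 := by
      intro h
      rw [h, norm_zero] at hwabs
      exact zero_ne_one hwabs
    refine ⟨Complex.arg w, fun θ => ?_⟩
    have hc : Real.cos (Complex.arg w) = P / M := by
      rw [Complex.cos_arg hw0, hwabs, div_one]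
    have hs : Real.sin (Complex.arg w) = Q / M := by
      rw [Complex.sin_arg, hwabs, div_one]
    rw [horizontal_inner_rotZ, ← hP, ← hQ, Real.cos_sub, hc, hs]
    field_simp

/-- **Lower bound on `|x − R_θy|`**: `|x − R_θ y|² ≥ r(x)² + r(y)² − 2(x₀(R_θy)₀ + x₁(R_θy)₁)`
(drop the axial component). [folklore] -/
theorem norm_sub_rotZ_sq_ge (θ : ℝ) (x y : ℝ³) :
    cylRadius x ^ 2 + cylRadius y ^ 2 - 2 * (x 0 * rotZ θ y 0 + x 1 * rotZ θ y 1) ≤ ‖x - rotZ θ y‖ ^ 2 := by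
  have hρ : cylRadius (rotZ θ y) ^ 2 = cylRadius y ^ 2 := by rw [cylRadius_rotZ]
  rw [cylRadius_sq, cylRadius_sq] at hρ
  rw [EuclideanSpace.norm_eq, Real.sq_sqrt (Finset.sum_nonneg fun i _ => sq_nonneg _), Fin.sum_univ_three]
  simp only [PiLp.sub_apply, Real.norm_eq_abs, sq_abs]
  rw [cylRadius_sq, cylRadius_sq]
  nlinarith [sq_nonneg (x 2 - rotZ θ y 2), hρ]

/-! ### The angular integral -/

/-- `(1 + a)⁻⁴ ≤ (1 + a²)⁻¹` for `a ≥ 0`. [folklore] -/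
theorem one_add_rpow_neg_four_le {a : ℝ} (ha : 0 ≤ a) : (1 + a) ^ (-4 : ℝ) ≤ (1 + a ^ 2)⁻¹ := by
  rw [show (-4 : ℝ) = -((4 : ℕ) : ℝ) by norm_num, Real.rpow_neg (by positivity), Real.rpow_natCast]
  refine inv_anti₀ (by positivity) ?_
  nlinarith [sq_nonneg a, pow_pos (by linarith : (0 : ℝ) < 1 + a) 3, mul_nonneg ha (sq_nonneg a)]

/-- **Jordan on a period**: `1 − cos ψ ≥ 2ψ²/π²` for `|ψ| ≤ π` (`1 − cos ψ = 2 sin²(ψ/2)` and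
`|sin(ψ/2)| ≥ |ψ|/π` there, the tree's `two_mul_abs_le_abs_sin_pi_mul`). [folklore] -/
theorem two_mul_sq_div_pi_sq_le_one_sub_cos {ψ : ℝ} (hψ : |ψ| ≤ π) :
    2 * ψ ^ 2 / π ^ 2 ≤ 1 - Real.cos ψ := by
  have hπ := Real.pi_pos
  have h1 : 1 - Real.cos ψ = 2 * Real.sin (ψ / 2) ^ 2 := by
    have h := Real.cos_two_mul (ψ / 2)
    rw [show 2 * (ψ / 2) = ψ by ring] at h
    nlinarith [Real.sin_sq_add_cos_sq (ψ / 2)]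
  have ht : |ψ / (2 * π)| ≤ 1 / 2 := by
    rw [abs_div, abs_of_pos (by positivity : (0 : ℝ) < 2 * π), div_le_iff₀ (by positivity)]
    linarith
  have hj := Torus.two_mul_abs_le_abs_sin_pi_mul ht
  have hsin : π * (ψ / (2 * π)) = ψ / 2 := by field_simp
  rw [hsin] at hj
  -- `2|ψ|/(2π) = |ψ|/π ≤ |sin(ψ/2)|`, square it
  have hj' : |ψ| / π ≤ |Real.sin (ψ / 2)| := by
    rw [abs_div, abs_of_pos (by positivity : (0 : ℝ) < 2 * π)] at hj
    calc |ψ| / π = 2 * (|ψ| / (2 * π)) := by field_simp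
      _ ≤ _ := hj
  have hj2 : (|ψ| / π) ^ 2 ≤ |Real.sin (ψ / 2)| ^ 2 := pow_le_pow_left₀ (by positivity) hj' 2
  rw [sq_abs, div_pow, sq_abs] at hj2
  rw [h1]
  have : 2 * ψ ^ 2 / π ^ 2 = 2 * (ψ ^ 2 / π ^ 2) := by ring
  rw [this]
  linarith

/-- `∫_{−π}^{π} dψ/(1 + (cψ)²) ≤ π/c` for `c > 0`. [folklore] -/
theorem integral_inv_one_add_sq_mul_le {c : ℝ} (hc : 0 < c) :
    ∫ ψ in (-π)..π, (1 + (c * ψ) ^ 2)⁻¹ ≤ π / c := by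
  have h := intervalIntegral.integral_comp_mul_left (fun z : ℝ => (1 + z ^ 2)⁻¹)
    (a := -π) (b := π) (c := c) hc.ne'
  rw [h, smul_eq_mul, show c * -π = -(c * π) by ring, integral_inv_one_add_sq, Real.arctan_neg,
    sub_neg_eq_add, inv_mul_le_iff₀ hc]
  have h1 : Real.arctan (c * π) < π / 2 := Real.arctan_lt_pi_div_two _
  calc Real.arctan (c * π) + Real.arctan (c * π) ≤ π := by linarith
    _ = c * (π / c) := by field_simp

/-- **The angular integral** (the circle `{R_θ y}` meets the unit ball about `x` in an arc of
angle `≲ (r(x)r(y))^{-1/2}` when `r(y) ≥ r(x)/2`, and stays at distance `≥ r(x)/2` otherwise):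
`∫₀^{2π} (1 + |x − R_θy|)⁻⁴ dθ ≤ 8π/(1 + r(x))` for all `x, y ∈ ℝ³`. [folklore] -/
theorem integral_angular_japanese_le (x y : ℝ³) :
    ∫ θ in (0 : ℝ)..(2 * π), (1 + ‖x - rotZ θ y‖) ^ (-4 : ℝ) ≤ 8 * π / (1 + cylRadius x) := by
  have hπ := Real.pi_pos
  set R : ℝ := cylRadius x with hR
  set ρ : ℝ := cylRadius y with hρ
  have hR0 : 0 ≤ R := cylRadius_nonneg _
  have hρ0 : 0 ≤ ρ := cylRadius_nonneg _
  obtain ⟨θ₀, hθ₀⟩ := exists_angle_horizontal_inner x y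
  -- the integrand and its basic properties
  have hcont : Continuous fun θ : ℝ => (1 + ‖x - rotZ θ y‖) ^ (-4 : ℝ) := by
    have hrot : Continuous fun θ : ℝ => rotZ θ y := continuous_rotZ_angle' y
    refine Continuous.rpow_const (continuous_const.add (continuous_const.sub hrot).norm) fun θ => Or.inl ?_
    have := norm_nonneg (x - rotZ θ y)
    linarith
  have hle1 : ∀ θ, (1 + ‖x - rotZ θ y‖) ^ (-4 : ℝ) ≤ 1 := fun θ => by
    rw [show (-4 : ℝ) = -((4 : ℕ) : ℝ) by norm_num, Real.rpow_neg (by positivity), Real.rpow_natCast]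
    exact inv_le_one_of_one_le₀ (one_le_pow₀ (by linarith [norm_nonneg (x - rotZ θ y)]))
  have hnn : ∀ θ, 0 ≤ (1 + ‖x - rotZ θ y‖) ^ (-4 : ℝ) := fun θ => Real.rpow_nonneg (by positivity) _
  -- the trivial bound `≤ 2π`
  have htriv : ∫ θ in (0 : ℝ)..(2 * π), (1 + ‖x - rotZ θ y‖) ^ (-4 : ℝ) ≤ 2 * π := by
    have := intervalIntegral.integral_mono_on (μ := volume) (a := (0 : ℝ)) (b := 2 * π) (by positivity)
      (hcont.intervalIntegrable _ _) intervalIntegrable_const (fun θ _ => hle1 θ)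
    simpa using this
  -- the lower bound on the distance
  have hdist : ∀ θ, R ^ 2 + ρ ^ 2 - 2 * (R * ρ * Real.cos (θ - θ₀)) ≤ ‖x - rotZ θ y‖ ^ 2 := fun θ => by
    have := norm_sub_rotZ_sq_ge θ x y
    rwa [hθ₀ θ] at this
  by_cases hcase : ρ ≤ R / 2
  · -- far circle: `|x − R_θy| ≥ R/2`
    have hpt : ∀ θ, (1 + ‖x - rotZ θ y‖) ^ (-4 : ℝ) ≤ 2 / (1 + R) := fun θ => by
      have hd : R / 2 ≤ ‖x - rotZ θ y‖ := by
        have h1 : (R - ρ) ^ 2 ≤ ‖x - rotZ θ y‖ ^ 2 := by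
          have hc := Real.cos_le_one (θ - θ₀)
          nlinarith [hdist θ, mul_nonneg hR0 hρ0]
        have h2 : R / 2 ≤ R - ρ := by linarith
        nlinarith [abs_le_abs h1, sq_nonneg (‖x - rotZ θ y‖ - (R - ρ)), norm_nonneg (x - rotZ θ y),
          sq_nonneg (‖x - rotZ θ y‖ + (R - ρ))]
      rw [show (-4 : ℝ) = -((4 : ℕ) : ℝ) by norm_num, Real.rpow_neg (by positivity), Real.rpow_natCast]
      rw [inv_le_comm₀ (by positivity) (by positivity)]
      have h3 : (1 + R) / 2 ≤ 1 + ‖x - rotZ θ y‖ := by linarith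
      calc (2 / (1 + R))⁻¹ = (1 + R) / 2 := by rw [inv_div]
        _ ≤ 1 + ‖x - rotZ θ y‖ := h3
        _ ≤ (1 + ‖x - rotZ θ y‖) ^ 4 := le_self_pow₀ (by linarith [norm_nonneg (x - rotZ θ y)]) (by norm_num)
    have := intervalIntegral.integral_mono_on (μ := volume) (a := (0 : ℝ)) (b := 2 * π) (by positivity)
      (hcont.intervalIntegrable _ _) intervalIntegrable_const (fun θ _ => hpt θ)
    rw [intervalIntegral.integral_const, smul_eq_mul] at this
    calc ∫ θ in (0 : ℝ)..(2 * π), (1 + ‖x - rotZ θ y‖) ^ (-4 : ℝ) ≤ (2 * π - 0) * (2 / (1 + R)) := this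
      _ = 4 * π / (1 + R) := by ring
      _ ≤ 8 * π / (1 + R) := by
          refine div_le_div_of_nonneg_right ?_ (by positivity)
          nlinarith
  · push Not at hcase
    by_cases hR1 : R ≤ 1
    · -- small radius: the trivial bound suffices
      calc ∫ θ in (0 : ℝ)..(2 * π), (1 + ‖x - rotZ θ y‖) ^ (-4 : ℝ) ≤ 2 * π := htriv
        _ ≤ 8 * π / (1 + R) := by
            rw [le_div_iff₀ (by positivity)]
            nlinarith
    · push Not at hR1
      have hRρ : 0 < R * ρ := mul_pos (by linarith) (by linarith)
      -- compare with the Lorentzian in the angle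
      set G : ℝ → ℝ := fun ψ => (1 + 2 * (R * ρ) * (1 - Real.cos ψ))⁻¹ with hG
      have hGc : Continuous G := by
        refine Continuous.inv₀ (by fun_prop) fun ψ => ?_
        have := Real.cos_le_one ψ
        nlinarith
      have hGper : Function.Periodic G (2 * π) := fun ψ => by simp [hG]
      have hIG : ∀ θ, (1 + ‖x - rotZ θ y‖) ^ (-4 : ℝ) ≤ G (θ - θ₀) := fun θ => by
        refine (one_add_rpow_neg_four_le (norm_nonneg _)).trans ?_
        simp only [hG]
        refine inv_anti₀ ?_ ?_
        · have := Real.cos_le_one (θ - θ₀)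
          nlinarith
        · have h2 : 2 * (R * ρ) ≤ R ^ 2 + ρ ^ 2 := by nlinarith [sq_nonneg (R - ρ)]
          have := hdist θ
          nlinarith [Real.cos_le_one (θ - θ₀)]
      have step1 : ∫ θ in (0 : ℝ)..(2 * π), (1 + ‖x - rotZ θ y‖) ^ (-4 : ℝ) ≤ ∫ θ in (0 : ℝ)..(2 * π), G (θ - θ₀) :=
        intervalIntegral.integral_mono_on (by positivity) (hcont.intervalIntegrable _ _)
          ((hGc.comp (continuous_id.sub continuous_const)).intervalIntegrable _ _) fun θ _ => hIG θ
      have step2 : ∫ θ in (0 : ℝ)..(2 * π), G (θ - θ₀) = ∫ ψ in (-π)..π, G ψ := by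
        rw [intervalIntegral.integral_comp_sub_right G θ₀, show (0 : ℝ) - θ₀ = -θ₀ by ring]
        have h1 := hGper.intervalIntegral_add_eq (-θ₀) (-π)
        rw [show -θ₀ + 2 * π = 2 * π - θ₀ by ring, show -π + 2 * π = π by ring] at h1
        exact h1
      -- on `[−π, π]` the Lorentzian bound
      set c : ℝ := 2 * Real.sqrt (R * ρ) / π with hc
      have hcpos : 0 < c := by rw [hc]; exact div_pos (mul_pos two_pos (Real.sqrt_pos.2 hRρ)) hπ
      have hc2 : c ^ 2 = 4 * (R * ρ) / π ^ 2 := by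
        rw [hc, div_pow, mul_pow, Real.sq_sqrt hRρ.le]
        ring
      have hGle : ∀ ψ ∈ Icc (-π) π, G ψ ≤ (1 + (c * ψ) ^ 2)⁻¹ := fun ψ hψ => by
        simp only [hG]
        refine inv_anti₀ (by positivity) ?_
        have hj := two_mul_sq_div_pi_sq_le_one_sub_cos (abs_le.2 ⟨hψ.1, hψ.2⟩)
        have : (c * ψ) ^ 2 = 2 * (R * ρ) * (2 * ψ ^ 2 / π ^ 2) := by
          rw [mul_pow, hc2]
          ring
        rw [this]
        nlinarith [mul_le_mul_of_nonneg_left hj (by positivity : (0 : ℝ) ≤ 2 * (R * ρ))]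
      have hLc : Continuous fun ψ : ℝ => (1 + (c * ψ) ^ 2)⁻¹ :=
        Continuous.inv₀ (by fun_prop) fun ψ => by positivity
      have step3 : ∫ ψ in (-π)..π, G ψ ≤ ∫ ψ in (-π)..π, (1 + (c * ψ) ^ 2)⁻¹ :=
        intervalIntegral.integral_mono_on (by linarith) (hGc.intervalIntegrable _ _) (hLc.intervalIntegrable _ _) hGle
      have step4 := integral_inv_one_add_sq_mul_le hcpos
      -- `π/c = π²/(2√(Rρ)) ≤ π²/(√2 R) ≤ 8π/(1 + R)`
      have hsqrt : R / Real.sqrt 2 ≤ Real.sqrt (R * ρ) := by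
        rw [div_le_iff₀ (Real.sqrt_pos.2 two_pos), ← Real.sqrt_mul hRρ.le]
        refine Real.le_sqrt_of_sq_le ?_
        nlinarith
      have hs2 : Real.sqrt 2 ≤ 3 / 2 := by
        rw [Real.sqrt_le_left (by norm_num)]
        norm_num
      have hπ4 : π ≤ 4 := Real.pi_le_four
      have step5 : π / c ≤ 8 * π / (1 + R) := by
        rw [hc, div_div_eq_mul_div]
        rw [div_le_div_iff₀ (mul_pos two_pos (Real.sqrt_pos.2 hRρ)) (by positivity)]
        -- `π² (1 + R) ≤ 16 π √(Rρ)`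
        have h1 : π * π * (1 + R) ≤ π * π * (2 * R) := by
          refine mul_le_mul_of_nonneg_left ?_ (by positivity)
          linarith
        have h2 : 2 * R ≤ 2 * Real.sqrt 2 * Real.sqrt (R * ρ) := by
          have := mul_le_mul_of_nonneg_left hsqrt (by positivity : (0 : ℝ) ≤ 2 * Real.sqrt 2)
          have hs0 : 0 < Real.sqrt 2 := Real.sqrt_pos.2 two_pos
          calc 2 * R = 2 * Real.sqrt 2 * (R / Real.sqrt 2) := by field_simp
            _ ≤ _ := this
        have h3 : π * π * (2 * Real.sqrt 2 * Real.sqrt (R * ρ)) ≤ 8 * π * (2 * Real.sqrt (R * ρ)) := by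
          have hs : 0 ≤ Real.sqrt (R * ρ) := Real.sqrt_nonneg _
          have hπs : π * Real.sqrt 2 ≤ 6 := by
            nlinarith [mul_le_mul hπ4 hs2 (Real.sqrt_nonneg 2) (by norm_num : (0 : ℝ) ≤ 4)]
          have e : π * π * (2 * Real.sqrt 2 * Real.sqrt (R * ρ)) = (π * Real.sqrt 2) * (2 * (π * Real.sqrt (R * ρ))) := by
            ring
          rw [e]
          nlinarith [mul_nonneg hπ.le hs]
        nlinarith [mul_le_mul_of_nonneg_left h2 (by positivity : (0 : ℝ) ≤ π * π)]
      calc ∫ θ in (0 : ℝ)..(2 * π), (1 + ‖x - rotZ θ y‖) ^ (-4 : ℝ)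
          ≤ ∫ ψ in (-π)..π, G ψ := step1.trans_eq step2
        _ ≤ π / c := step3.trans step4
        _ ≤ 8 * π / (1 + R) := step5

/-- Rotations about the axis are linear: `R_θ (a y) = a R_θ y`. [folklore] -/
private theorem rotZ_const_smul (θ a : ℝ) (y : ℝ³) : rotZ θ (a • y) = a • rotZ θ y := by
  ext i
  fin_cases i <;> simp <;> ring

/-! ### The Littlewood–Paley kernel: Schwartz decay and dyadic scaling -/

/-- **Schwartz decay of the block kernel**: `|K₀(z)| ≤ C_K (1 + |z|)⁻⁴` on `ℝ³`. [folklore] -/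
theorem exists_blockKernel_zero_le :
    ∃ C : ℝ, 0 < C ∧ ∀ z : ℝ³, ‖blockKernel ℝ³ 0 z‖ ≤ C * (1 + ‖z‖) ^ (-4 : ℝ) := by
  set f : SchwartzMap ℝ³ ℂ := blockKernelC ℝ³ 0 with hf
  obtain ⟨S, hS⟩ : ∃ S : ℝ, S = 2 ^ (4 : ℕ) *
      (Finset.Iic ((4 : ℕ), (0 : ℕ))).sup (fun m => SchwartzMap.seminorm ℝ m.1 m.2) f := ⟨_, rfl⟩
  have hS0 : 0 ≤ S := by rw [hS]; positivity
  refine ⟨S + 1, by linarith, fun z => ?_⟩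
  have h := SchwartzMap.one_add_le_sup_seminorm_apply (𝕜 := ℝ) (m := ((4 : ℕ), (0 : ℕ))) (k := 4) (n := 0)
    le_rfl le_rfl f z
  rw [norm_iteratedFDeriv_zero, ← hS] at h
  have hpos : 0 < (1 + ‖z‖) ^ (4 : ℕ) := by positivity
  rw [norm_blockKernel, show blockKernelC ℝ³ 0 z = f z from rfl,
    show (-4 : ℝ) = -((4 : ℕ) : ℝ) by norm_num, Real.rpow_neg (by positivity), Real.rpow_natCast,
    ← div_eq_mul_inv, le_div_iff₀ hpos]
  calc ‖f z‖ * (1 + ‖z‖) ^ 4 = (1 + ‖z‖) ^ 4 * ‖f z‖ := mul_comm _ _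
    _ ≤ S := h
    _ ≤ S + 1 := by linarith

/-- **The dyadic majorant**: `|K_j(z)| ≤ C_K 2^{3j} (1 + 2^j|z|)⁻⁴`. [folklore] -/
theorem exists_blockKernel_le :
    ∃ C : ℝ, 0 < C ∧ ∀ (j : ℤ) (z : ℝ³),
      ‖blockKernel ℝ³ j z‖ ≤ C * ((2 : ℝ) ^ j) ^ 3 * (1 + (2 : ℝ) ^ j * ‖z‖) ^ (-4 : ℝ) := by
  obtain ⟨C, hC, h⟩ := exists_blockKernel_zero_le
  refine ⟨C, hC, fun j z => ?_⟩
  have h2j : (0 : ℝ) < (2 : ℝ) ^ j := zpow_pos two_pos _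
  rw [blockKernel_eq_scale, norm_mul, Real.norm_eq_abs, finrank_euclideanSpace_fin]
  have hz : (2 : ℝ) ^ ((j : ℤ) * ((3 : ℕ) : ℤ)) = ((2 : ℝ) ^ j) ^ 3 := by
    rw [zpow_mul, zpow_natCast]
  rw [hz, abs_of_pos (pow_pos h2j 3)]
  have h1 := h (((2 : ℝ) ^ j) • z)
  rw [norm_smul, Real.norm_of_nonneg h2j.le] at h1
  calc ((2 : ℝ) ^ j) ^ 3 * ‖blockKernel ℝ³ 0 (((2 : ℝ) ^ j) • z)‖
      ≤ ((2 : ℝ) ^ j) ^ 3 * (C * (1 + (2 : ℝ) ^ j * ‖z‖) ^ (-4 : ℝ)) := mul_le_mul_of_nonneg_left h1 (by positivity)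
    _ = _ := by ring

/-- The majorant profile is integrable on `ℝ³` (`4 > 3`). [folklore] -/
theorem lintegral_japanese_lt_top :
    ∫⁻ z : ℝ³, ENNReal.ofReal ((1 + ‖z‖) ^ (-4 : ℝ)) < ∞ :=
  finite_integral_one_add_norm (by rw [finrank_euclideanSpace_fin]; norm_num)

/-- **Scale invariance of the mass of the majorant**:
`∫ 2^{3j}(1 + 2^j|z|)⁻⁴ dz = ∫ (1 + |z|)⁻⁴ dz`. [folklore] -/
theorem lintegral_dyadic_japanese (j : ℤ) :
    ∫⁻ z : ℝ³, ENNReal.ofReal (((2 : ℝ) ^ j) ^ 3 * (1 + (2 : ℝ) ^ j * ‖z‖) ^ (-4 : ℝ)) =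
      ∫⁻ z : ℝ³, ENNReal.ofReal ((1 + ‖z‖) ^ (-4 : ℝ)) := by
  have h2j : (0 : ℝ) < (2 : ℝ) ^ j := zpow_pos two_pos _
  have hc0 : ((2 : ℝ) ^ j) ≠ 0 := h2j.ne'
  set g : ℝ³ → ℝ≥0∞ := fun z => ENNReal.ofReal ((1 + ‖z‖) ^ (-4 : ℝ)) with hg
  have h1 : (fun z : ℝ³ => ENNReal.ofReal (((2 : ℝ) ^ j) ^ 3 * (1 + (2 : ℝ) ^ j * ‖z‖) ^ (-4 : ℝ))) =
      fun z => ENNReal.ofReal (((2 : ℝ) ^ j) ^ 3) * g (((2 : ℝ) ^ j) • z) := by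
    funext z
    rw [hg]
    simp only
    rw [norm_smul, Real.norm_eq_abs, abs_of_pos h2j, ENNReal.ofReal_mul (by positivity)]
  rw [h1, lintegral_const_mul' _ _ ENNReal.ofReal_ne_top]
  -- change of variables `z ↦ 2^j z`
  let e : ℝ³ ≃ᵐ ℝ³ := (Homeomorph.smul (isUnit_iff_ne_zero.2 hc0).unit).toMeasurableEquiv
  have he : (e : ℝ³ → ℝ³) = fun x => ((2 : ℝ) ^ j) • x := rfl
  have h3 : ∫⁻ z, g (((2 : ℝ) ^ j) • z) = ENNReal.ofReal ((((2 : ℝ) ^ j) ^ 3)⁻¹) * ∫⁻ z, g z := by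
    calc ∫⁻ z, g (((2 : ℝ) ^ j) • z) = ∫⁻ y, g y ∂(Measure.map (fun x => ((2 : ℝ) ^ j) • x) volume) := by
          rw [← he, lintegral_map_equiv]; rfl
      _ = ENNReal.ofReal ((((2 : ℝ) ^ j) ^ 3)⁻¹) * ∫⁻ z, g z := by
          rw [Measure.map_addHaar_smul volume hc0, lintegral_smul_measure, finrank_euclideanSpace_fin,
            abs_of_nonneg (by positivity)]
          rfl
  rw [h3, ← mul_assoc, ← ENNReal.ofReal_mul (by positivity), mul_inv_cancel₀ (pow_ne_zero 3 hc0), ENNReal.ofReal_one,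
    one_mul]

/-! ### The angular average of the majorant -/

/-- **The scaled angular bound**, in `ℝ≥0∞` form:
`∫₀^{2π} 2^{3j}(1 + 2^j|x − R_θy|)⁻⁴ dθ ≤ 2^{3j} · 8π/(1 + 2^j r(x))`. [folklore] -/
theorem lintegral_angular_dyadic_le (j : ℤ) (x y : ℝ³) :
    ∫⁻ θ in Ioc (0 : ℝ) (2 * π), ENNReal.ofReal (((2 : ℝ) ^ j) ^ 3 * (1 + (2 : ℝ) ^ j * ‖x - rotZ θ y‖) ^ (-4 : ℝ)) ≤
      ENNReal.ofReal (((2 : ℝ) ^ j) ^ 3 * (8 * π / (1 + (2 : ℝ) ^ j * cylRadius x))) := by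
  have hπ := Real.pi_pos
  have h2j : (0 : ℝ) < (2 : ℝ) ^ j := zpow_pos two_pos _
  -- `2^j |x − R_θ y| = |2^j x − R_θ (2^j y)|`
  have hscale : ∀ θ, (2 : ℝ) ^ j * ‖x - rotZ θ y‖ = ‖((2 : ℝ) ^ j) • x - rotZ θ (((2 : ℝ) ^ j) • y)‖ := fun θ => by
    rw [rotZ_const_smul, ← smul_sub, norm_smul, Real.norm_of_nonneg h2j.le]
  have hcont : Continuous fun θ : ℝ => ((2 : ℝ) ^ j) ^ 3 * (1 + (2 : ℝ) ^ j * ‖x - rotZ θ y‖) ^ (-4 : ℝ) := by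
    refine continuous_const.mul (Continuous.rpow_const ?_ fun θ => Or.inl ?_)
    · exact continuous_const.add (continuous_const.mul (continuous_const.sub (continuous_rotZ_angle' y)).norm)
    · have := norm_nonneg (x - rotZ θ y)
      positivity
  have hnn : ∀ θ, 0 ≤ ((2 : ℝ) ^ j) ^ 3 * (1 + (2 : ℝ) ^ j * ‖x - rotZ θ y‖) ^ (-4 : ℝ) := fun θ => by positivity
  rw [← ofReal_integral_eq_lintegral_ofReal (hcont.integrableOn_Icc.mono_set Ioc_subset_Icc_self)
    (ae_of_all _ fun θ => hnn θ)]
  refine ENNReal.ofReal_le_ofReal ?_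
  rw [← intervalIntegral.integral_of_le (by positivity), intervalIntegral.integral_const_mul]
  refine mul_le_mul_of_nonneg_left ?_ (by positivity)
  have key := integral_angular_japanese_le (((2 : ℝ) ^ j) • x) (((2 : ℝ) ^ j) • y)
  rw [cylRadius_smul, abs_of_pos h2j] at key
  refine le_trans (le_of_eq ?_) key
  refine intervalIntegral.integral_congr fun θ _ => ?_
  simp only [hscale θ]

/-! ### The axisymmetric Bernstein inequality for blocks -/

/-- `3/2` and `3` are Hölder conjugate. [folklore] -/
private theorem holderConjugate_threeHalves_three : (3 / 2 : ℝ).HolderConjugate 3 := by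
  rw [Real.holderConjugate_iff]
  norm_num

set_option maxHeartbeats 1600000 in
/-- **Palasek 2021, Prop 1 in the case `p = ∞`, `q = 3`, `β = 0`, `α = 1/3` for the
Littlewood–Paley blocks** ("If `|u|` is axisymmetric, then the condition `α ≤ β` can be improved to
`α ≤ β + 1/q − 1/p`"; here `1/q − 1/p = 1/3`): there is an absolute constant `C` such that for every
`j : ℤ`, every measurable field `u : ℝ³ → E'` whose pointwise norm is axisymmetric
(`‖u(R_θ y)‖ = ‖u(y)‖`), and every `x ∈ ℝ³`,
`r(x)^{1/3} ‖Δ̇_j u(x)‖ ≤ C 2^{2j/3} ‖u‖_{L³}` (`r` the distance to the axis). This is the bound used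
in the proof of Prop 11, p. 45: "`A₁⁻¹N₀ ≤ |P_{N₀}u(t₀,x₀)| ≲ r(x₀)^{−1+θ_q}N₀^{θ_q}A`", `θ_q = 2/3`.
Proof by angular averaging (module docstring), a shorter road than the printed one. [cite: Palasek2021, Prop 1 (axisymmetric case) and §5 (proof of Prop 11)] -/
theorem axisym_blockFn_weighted_bound {E' : Type*} [NormedAddCommGroup E'] [NormedSpace ℝ E'] :
    ∃ C : ℝ, 0 < C ∧ ∀ (j : ℤ) (u : ℝ³ → E') (x : ℝ³),
      AEStronglyMeasurable u volume → (∀ (θ : ℝ) (y : ℝ³), ‖u (rotZ θ y)‖ = ‖u y‖) →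
      eLpNorm u 3 volume < ∞ →
      cylRadius x ^ (1 / 3 : ℝ) * ‖blockFn j u x‖ ≤
        C * (2 : ℝ) ^ ((2 / 3 : ℝ) * j) * (eLpNorm u 3 volume).toReal := by
  obtain ⟨CK, hCK, hK⟩ := exists_blockKernel_le
  -- the mass of the majorant
  obtain ⟨I₀, hI₀⟩ : ∃ I₀ : ℝ≥0∞, I₀ = ∫⁻ z : ℝ³, ENNReal.ofReal ((1 + ‖z‖) ^ (-4 : ℝ)) := ⟨_, rfl⟩
  have hI₀top : I₀ ≠ ∞ := by rw [hI₀]; exact lintegral_japanese_lt_top.ne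
  -- the constant
  refine ⟨CK * (4 : ℝ) ^ (1 / 3 : ℝ) * (I₀.toReal) ^ (2 / 3 : ℝ) + 1, by positivity, ?_⟩
  intro j u x hu hax hu3
  have hπ := Real.pi_pos
  have h2j : (0 : ℝ) < (2 : ℝ) ^ j := zpow_pos two_pos _
  set R : ℝ := cylRadius x with hR
  have hR0 : 0 ≤ R := cylRadius_nonneg _
  -- the majorant `κ` and the field `f = ‖u‖ₑ`
  set κ : ℝ³ → ℝ := fun z => ((2 : ℝ) ^ j) ^ 3 * (1 + (2 : ℝ) ^ j * ‖z‖) ^ (-4 : ℝ) with hκ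
  have hκnn : ∀ z, 0 ≤ κ z := fun z => by positivity
  have hκc : Continuous κ := by
    refine continuous_const.mul (Continuous.rpow_const (by fun_prop) fun z => Or.inl ?_)
    positivity
  set f : ℝ³ → ℝ≥0∞ := fun y => ‖u y‖ₑ with hf
  have hfm : AEMeasurable f volume := hu.enorm
  have hfax : ∀ θ y, f (rotZ θ y) = f y := fun θ y => by
    simp only [hf]
    rw [← ofReal_norm, ← ofReal_norm, hax θ y]
  -- Step 1: the block is dominated by the majorant convolution
  have step1 : ‖blockFn j u x‖ₑ ≤ ENNReal.ofReal CK * ∫⁻ y, ENNReal.ofReal (κ (x - y)) * f y := by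
    rw [blockFn_apply]
    refine (enorm_integral_le_lintegral_enorm _).trans ?_
    have h1 : ∀ t, ‖blockKernel ℝ³ j t • u (x - t)‖ₑ ≤ ENNReal.ofReal CK * (ENNReal.ofReal (κ t) * f (x - t)) := by
      intro t
      rw [enorm_smul, ← mul_assoc, ← ENNReal.ofReal_mul hCK.le]
      refine mul_le_mul_left ?_ _
      rw [← ofReal_norm]
      have := hK j t
      rw [mul_assoc] at this
      exact ENNReal.ofReal_le_ofReal this
    calc ∫⁻ t, ‖blockKernel ℝ³ j t • u (x - t)‖ₑ ≤ ∫⁻ t, ENNReal.ofReal CK * (ENNReal.ofReal (κ t) * f (x - t)) :=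
          lintegral_mono fun t => h1 t
      _ = ENNReal.ofReal CK * ∫⁻ t, ENNReal.ofReal (κ t) * f (x - t) := by
          rw [lintegral_const_mul' _ _ ENNReal.ofReal_ne_top]
      _ = ENNReal.ofReal CK * ∫⁻ y, ENNReal.ofReal (κ (x - y)) * f y := by
          congr 1
          -- `t = x − y`
          have := lintegral_sub_left_eq_self (μ := (volume : Measure ℝ³))
            (fun y => ENNReal.ofReal (κ (x - y)) * f y) x
          simp only [sub_sub_cancel] at this
          exact this
  -- Step 2: rotation invariance of the majorant convolution
  set A : ℝ≥0∞ := ∫⁻ y, ENNReal.ofReal (κ (x - y)) * f y with hA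
  have step2 : ∀ θ : ℝ, A = ∫⁻ y, ENNReal.ofReal (κ (x - rotZ θ y)) * f y := by
    intro θ
    have hmp : MeasurePreserving (rotZLIE θ) volume volume := (rotZLIE θ).measurePreserving
    have := hmp.lintegral_comp_emb (rotZLIE θ).toMeasurableEquiv.measurableEmbedding
      (fun y => ENNReal.ofReal (κ (x - y)) * f y)
    simp only [rotZLIE_apply] at this
    rw [hA, ← this]
    refine lintegral_congr fun y => ?_
    rw [hfax θ y]
  -- Step 3: average over the angle (Tonelli)
  set Kbar : ℝ³ → ℝ≥0∞ := fun y => ∫⁻ θ in Ioc (0 : ℝ) (2 * π), ENNReal.ofReal (κ (x - rotZ θ y)) with hKbar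
  have hmeasK : Measurable fun p : ℝ × ℝ³ => ENNReal.ofReal (κ (x - rotZ p.1 p.2)) :=
    ENNReal.measurable_ofReal.comp (hκc.comp (continuous_const.sub continuous_rotZ_prod')).measurable
  have hKbar_meas : Measurable Kbar := hmeasK.lintegral_prod_left'
  have hprodm : ∀ μ : Measure ℝ, AEMeasurable (uncurry fun (θ : ℝ) (y : ℝ³) => ENNReal.ofReal (κ (x - rotZ θ y)) * f y)
      (μ.prod volume) := fun μ => hmeasK.aemeasurable.mul hfm.comp_snd
  have step3 : ENNReal.ofReal (2 * π) * A = ∫⁻ y, Kbar y * f y := by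
    have h1 : ∫⁻ θ in Ioc (0 : ℝ) (2 * π), ∫⁻ y, ENNReal.ofReal (κ (x - rotZ θ y)) * f y = ENNReal.ofReal (2 * π) * A := by
      rw [lintegral_congr (fun θ => (step2 θ).symm), setLIntegral_const, Real.volume_Ioc, sub_zero, mul_comm]
    rw [← h1, lintegral_lintegral_swap (hprodm _)]
    refine lintegral_congr fun y => ?_
    have hm1 : Measurable (fun θ : ℝ => ENNReal.ofReal (κ (x - rotZ θ y))) :=
      ENNReal.measurable_ofReal.comp (hκc.comp (continuous_const.sub (continuous_rotZ_angle' y))).measurable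
    exact lintegral_mul_const (f y) hm1
  -- Step 4: the sup bound and the mass of the angular average
  obtain ⟨Sr, hSr⟩ : ∃ Sr : ℝ, Sr = ((2 : ℝ) ^ j) ^ 3 * (8 * π / (1 + (2 : ℝ) ^ j * R)) := ⟨_, rfl⟩
  have hSr0 : 0 < Sr := by rw [hSr]; positivity
  have hsup : ∀ y, Kbar y ≤ ENNReal.ofReal Sr := fun y => by
    rw [hSr]
    exact lintegral_angular_dyadic_le j x y
  have hmass : ∫⁻ y, Kbar y = ENNReal.ofReal (2 * π) * I₀ := by
    have hsw : ∫⁻ y, Kbar y = ∫⁻ θ in Ioc (0 : ℝ) (2 * π), ∫⁻ y, ENNReal.ofReal (κ (x - rotZ θ y)) := by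
      rw [hKbar]
      exact lintegral_lintegral_swap (μ := volume) (ν := volume.restrict (Ioc (0 : ℝ) (2 * π)))
        (f := fun (y : ℝ³) (θ : ℝ) => ENNReal.ofReal (κ (x - rotZ θ y))) (hmeasK.comp measurable_swap).aemeasurable
    have hinner : ∀ θ : ℝ, ∫⁻ y, ENNReal.ofReal (κ (x - rotZ θ y)) = I₀ := fun θ => by
      have hmp : MeasurePreserving (rotZLIE θ) volume volume := (rotZLIE θ).measurePreserving
      have h1 := hmp.lintegral_comp_emb (rotZLIE θ).toMeasurableEquiv.measurableEmbedding
        (fun y => ENNReal.ofReal (κ (x - y)))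
      simp only [rotZLIE_apply] at h1
      rw [h1]
      have h2 := lintegral_sub_left_eq_self (μ := (volume : Measure ℝ³)) (fun y => ENNReal.ofReal (κ y)) x
      rw [h2, hI₀, hκ]
      exact lintegral_dyadic_japanese j
    rw [hsw, lintegral_congr (fun θ => hinner θ), setLIntegral_const, Real.volume_Ioc, sub_zero, mul_comm]
  -- Step 5: interpolation `∫ K̄^{3/2} ≤ S^{1/2} ∫ K̄`
  have hinterp : ∫⁻ y, Kbar y ^ (3 / 2 : ℝ) ≤ ENNReal.ofReal Sr ^ (1 / 2 : ℝ) * (ENNReal.ofReal (2 * π) * I₀) := by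
    rw [← hmass, ← lintegral_const_mul' _ _ (ENNReal.rpow_ne_top_of_nonneg (by norm_num) ENNReal.ofReal_ne_top)]
    refine lintegral_mono fun y => ?_
    rw [show (3 / 2 : ℝ) = 1 + 1 / 2 by norm_num, ENNReal.rpow_add_of_nonneg _ _ zero_le_one (by norm_num),
      ENNReal.rpow_one, mul_comm]
    exact mul_le_mul_left (ENNReal.rpow_le_rpow (hsup y) (by norm_num)) _
  -- Step 6: Hölder
  have hholder : ∫⁻ y, Kbar y * f y ≤ (∫⁻ y, Kbar y ^ (3 / 2 : ℝ)) ^ (1 / (3 / 2 : ℝ)) * (∫⁻ y, f y ^ (3 : ℝ)) ^ (1 / (3 : ℝ)) :=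
    ENNReal.lintegral_mul_le_Lp_mul_Lq volume holderConjugate_threeHalves_three hKbar_meas.aemeasurable hfm
  have hnorm : (∫⁻ y, f y ^ (3 : ℝ)) ^ (1 / (3 : ℝ)) = eLpNorm u 3 volume := by
    rw [eLpNorm_eq_lintegral_rpow_enorm_toReal (by norm_num) (by norm_num), ENNReal.toReal_ofNat]
  -- Step 7: everything is finite; pass to real numbers
  obtain ⟨I₀r, hI₀r⟩ : ∃ I₀r : ℝ, I₀r = I₀.toReal := ⟨_, rfl⟩
  have hI₀r0 : 0 ≤ I₀r := by rw [hI₀r]; exact ENNReal.toReal_nonneg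
  have hI₀eq : I₀ = ENNReal.ofReal I₀r := by rw [hI₀r, ENNReal.ofReal_toReal hI₀top]
  obtain ⟨Nr, hNr⟩ : ∃ Nr : ℝ, Nr = (eLpNorm u 3 volume).toReal := ⟨_, rfl⟩
  have hNr0 : 0 ≤ Nr := by rw [hNr]; exact ENNReal.toReal_nonneg
  have hNeq : eLpNorm u 3 volume = ENNReal.ofReal Nr := by rw [hNr, ENNReal.ofReal_toReal hu3.ne]
  -- the real bound `M` for `2π A`
  obtain ⟨M, hM⟩ : ∃ M : ℝ, M = (Sr ^ (1 / 2 : ℝ) * (2 * π * I₀r)) ^ (2 / 3 : ℝ) * Nr := ⟨_, rfl⟩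
  have hM0 : 0 ≤ M := by rw [hM]; positivity
  have hE1 : ENNReal.ofReal (2 * π) * A ≤ ENNReal.ofReal M := by
    rw [step3]
    refine hholder.trans ?_
    rw [hnorm, hNeq, hM, ENNReal.ofReal_mul (by positivity)]
    refine mul_le_mul_left ?_ _
    have h1 : (∫⁻ y, Kbar y ^ (3 / 2 : ℝ)) ^ (1 / (3 / 2 : ℝ)) ≤
        (ENNReal.ofReal Sr ^ (1 / 2 : ℝ) * (ENNReal.ofReal (2 * π) * I₀)) ^ (1 / (3 / 2 : ℝ)) :=
      ENNReal.rpow_le_rpow hinterp (by norm_num)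
    refine h1.trans (le_of_eq ?_)
    rw [hI₀eq, ← ENNReal.ofReal_mul (by positivity), ENNReal.ofReal_rpow_of_nonneg hSr0.le (by norm_num),
      ← ENNReal.ofReal_mul (by positivity), ENNReal.ofReal_rpow_of_nonneg (by positivity) (by norm_num)]
    norm_num
  have hAtop : A ≠ ∞ := by
    intro hA'
    rw [hA', ENNReal.mul_top (by positivity)] at hE1
    exact ENNReal.ofReal_ne_top (top_le_iff.1 hE1)
  have hAreal : 2 * π * A.toReal ≤ M := by
    have := ENNReal.toReal_mono ENNReal.ofReal_ne_top hE1
    rwa [ENNReal.toReal_mul, ENNReal.toReal_ofReal (by positivity), ENNReal.toReal_ofReal hM0] at this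
  have hblock : ‖blockFn j u x‖ ≤ CK * A.toReal := by
    have h1 : ‖blockFn j u x‖ₑ ≤ ENNReal.ofReal (CK * A.toReal) := by
      rw [ENNReal.ofReal_mul hCK.le, ENNReal.ofReal_toReal hAtop]
      exact step1
    rwa [← ofReal_norm, ENNReal.ofReal_le_ofReal_iff (by positivity)] at h1
  -- Step 8: real arithmetic — `R^{1/3} (S^{1/2} 2π I₀)^{2/3} ≤ 2π · 4^{1/3} I₀^{2/3} 2^{2j/3}` by cubing
  have hcube : ∀ {t : ℝ}, 0 ≤ t → (t ^ (1 / 3 : ℝ)) ^ 3 = t := fun {t} ht => by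
    rw [← Real.rpow_natCast, ← Real.rpow_mul ht]; norm_num
  have hcube2 : ∀ {t : ℝ}, 0 ≤ t → (t ^ (2 / 3 : ℝ)) ^ 3 = t ^ 2 := fun {t} ht => by
    rw [← Real.rpow_natCast, ← Real.rpow_mul ht]; norm_num
  have hsq : ∀ {t : ℝ}, 0 ≤ t → (t ^ (1 / 2 : ℝ)) ^ 2 = t := fun {t} ht => by
    rw [← Real.rpow_natCast, ← Real.rpow_mul ht]; norm_num
  have h2pow : ((2 : ℝ) ^ ((2 / 3 : ℝ) * j)) ^ 3 = ((2 : ℝ) ^ j) ^ 2 := by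
    rw [← Real.rpow_natCast, ← Real.rpow_mul zero_le_two, show (2 / 3 : ℝ) * j * ((3 : ℕ) : ℝ) = (j : ℝ) * 2 by push_cast; ring,
      Real.rpow_mul zero_le_two, Real.rpow_intCast, show (2 : ℝ) = ((2 : ℕ) : ℝ) by norm_num, Real.rpow_natCast]
  have key_real : R ^ (1 / 3 : ℝ) * (Sr ^ (1 / 2 : ℝ) * (2 * π * I₀r)) ^ (2 / 3 : ℝ) ≤
      2 * π * ((4 : ℝ) ^ (1 / 3 : ℝ) * I₀r ^ (2 / 3 : ℝ) * (2 : ℝ) ^ ((2 / 3 : ℝ) * j)) := by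
    refine (pow_le_pow_iff_left₀ (by positivity) (by positivity) (three_ne_zero)).1 ?_
    have hL : (R ^ (1 / 3 : ℝ) * (Sr ^ (1 / 2 : ℝ) * (2 * π * I₀r)) ^ (2 / 3 : ℝ)) ^ 3 = R * (Sr * (2 * π * I₀r) ^ 2) := by
      rw [mul_pow, hcube hR0, hcube2 (by positivity), mul_pow (Sr ^ (1 / 2 : ℝ)), hsq hSr0.le]
    have hRHS : (2 * π * ((4 : ℝ) ^ (1 / 3 : ℝ) * I₀r ^ (2 / 3 : ℝ) * (2 : ℝ) ^ ((2 / 3 : ℝ) * j))) ^ 3 =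
        (2 * π) ^ 3 * (4 * I₀r ^ 2 * ((2 : ℝ) ^ j) ^ 2) := by
      rw [mul_pow (2 * π), mul_pow ((4 : ℝ) ^ (1 / 3 : ℝ) * I₀r ^ (2 / 3 : ℝ)), mul_pow ((4 : ℝ) ^ (1 / 3 : ℝ)),
        hcube (by norm_num), hcube2 hI₀r0, h2pow]
    rw [hL, hRHS]
    -- `R Sr ≤ 8π (2^j)²` since `2^jR/(1 + 2^jR) ≤ 1`
    have hSr_le : R * Sr ≤ 8 * π * ((2 : ℝ) ^ j) ^ 2 := by
      rw [hSr]
      have hfrac : (2 : ℝ) ^ j * R / (1 + (2 : ℝ) ^ j * R) ≤ 1 := by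
        rw [div_le_one (by positivity)]
        linarith
      have e : R * (((2 : ℝ) ^ j) ^ 3 * (8 * π / (1 + (2 : ℝ) ^ j * R))) =
          8 * π * ((2 : ℝ) ^ j) ^ 2 * ((2 : ℝ) ^ j * R / (1 + (2 : ℝ) ^ j * R)) := by
        rw [mul_div_assoc, mul_div_assoc]
        ring
      rw [e]
      have h8 : 0 ≤ 8 * π * ((2 : ℝ) ^ j) ^ 2 := by positivity
      nlinarith [mul_le_mul_of_nonneg_left hfrac h8]
    calc R * (Sr * (2 * π * I₀r) ^ 2) = (R * Sr) * (2 * π * I₀r) ^ 2 := by ring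
      _ ≤ (8 * π * ((2 : ℝ) ^ j) ^ 2) * (2 * π * I₀r) ^ 2 := mul_le_mul_of_nonneg_right hSr_le (by positivity)
      _ = (2 * π) ^ 3 * (4 * I₀r ^ 2 * ((2 : ℝ) ^ j) ^ 2) := by ring
  -- conclude
  have hfin : cylRadius x ^ (1 / 3 : ℝ) * ‖blockFn j u x‖ ≤
      CK * (4 : ℝ) ^ (1 / 3 : ℝ) * I₀r ^ (2 / 3 : ℝ) * (2 : ℝ) ^ ((2 / 3 : ℝ) * j) * Nr := by
    have h1 : cylRadius x ^ (1 / 3 : ℝ) * ‖blockFn j u x‖ ≤ R ^ (1 / 3 : ℝ) * (CK * (M / (2 * π))) := by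
      rw [← hR]
      refine mul_le_mul_of_nonneg_left (hblock.trans (mul_le_mul_of_nonneg_left ?_ hCK.le)) (by positivity)
      rw [le_div_iff₀ (by positivity)]
      linarith
    refine h1.trans ?_
    rw [hM]
    have e : R ^ (1 / 3 : ℝ) * (CK * ((Sr ^ (1 / 2 : ℝ) * (2 * π * I₀r)) ^ (2 / 3 : ℝ) * Nr / (2 * π))) =
        CK * Nr / (2 * π) * (R ^ (1 / 3 : ℝ) * (Sr ^ (1 / 2 : ℝ) * (2 * π * I₀r)) ^ (2 / 3 : ℝ)) := by
      ring
    rw [e]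
    have hc0 : 0 ≤ CK * Nr / (2 * π) := by positivity
    calc CK * Nr / (2 * π) * (R ^ (1 / 3 : ℝ) * (Sr ^ (1 / 2 : ℝ) * (2 * π * I₀r)) ^ (2 / 3 : ℝ))
        ≤ CK * Nr / (2 * π) * (2 * π * ((4 : ℝ) ^ (1 / 3 : ℝ) * I₀r ^ (2 / 3 : ℝ) * (2 : ℝ) ^ ((2 / 3 : ℝ) * j))) :=
          mul_le_mul_of_nonneg_left key_real hc0
      _ = _ := by
          field_simp
  refine hfin.trans ?_
  rw [← hI₀r, ← hNr]
  have : 0 ≤ (2 : ℝ) ^ ((2 / 3 : ℝ) * j) * Nr := by positivity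
  nlinarith

end PalasekBernstein

end Literature.Analysis.FluidPDE

end
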